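import Literature.Analysis.Matrix.EigenvalueCountCertificates
import Literature.Analysis.Matrix.SingularValueVerificationBounds
import Literature.Analysis.InnerProduct.WeinsteinBound
import HarnessLib

/-!
# Rump's inertia-based lower bound for the smallest singular value of a symmetric matrix
# (two shifted `LDLᵀ`-type factorisations with equal inertia ⇒ `σ_min(A) > s − max residual`)

Topic `Analysis/Matrix`; namespace `Literature.Analysis.Matrix.InertiaSigmaMin`. Companion to
`EigenvalueCountCertificates` (the one-sided residual COUNT certificates) and to
`SingularValueVerificationBounds` (Rump 1993's Cholesky route for the positive definite case): this file is
the SYMMETRIC INDEFINITE case, the soundness statement behind Rump's sparse verifiers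
`verifySparseNearSym2` / `verifySparseGen2` and behind every «inertia-based» verified sparse solver.

SOURCES (held, read on the page; author's versions in the literature store).

* S. M. Rump, *Verified error bounds for sparse systems, Part I: the splitting of a matrix into two
  factors*, to appear in SIAM J. Matrix Anal. Appl. (2026) [Rump2026SparseI] (`paper:url-16a6c3477380`,
  p. 2, Theorem 1.1, quoting [48] = S. M. Rump, ZAMM 75 (1995) S439–S442 [Rump1995SparseZAMM], Thm 1.1):
  > **Theorem 1.1.** Let symmetric `A ∈ ℝⁿˣⁿ`, `0 < λ̃ ∈ ℝ` and `L̃₁, D̃₁, L̃₂, D̃₂ ∈ ℝⁿˣⁿ` be given. If the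
  > inertia of `D̃₁` and `D̃₂` are equal, then for any matrix norm
  > `σ_min(A) > λ̃ − max{‖A − λ̃I − L̃₁D̃₁L̃₁ᵀ‖, ‖A + λ̃I − L̃₂D̃₂L̃₂ᵀ‖}` (1.3).
  > If all eigenvalues of `D̃₁` are positive, then `σ_min(A) > λ̃ − ‖A − λ̃I − L̃₁D̃₁L̃₁ᵀ‖` (1.4).
* S. M. Rump, *Part II: inertia-based bounds, least squares and nonlinear systems* [Rump2026SparseII]
  (`paper:url-d6385cb74db9`), p. 2 «The proof is clear from the fact that the inertia of `L̃_kD̃_kL̃_kᵀ` and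
  `D̃_k` coincide», p. 3 «If `σ_min(A) ≥ ϱ > 0`, then … `‖A⁻¹b − x̃‖_∞ ≤ ‖A⁻¹(b − Ax̃)‖₂ ≤ ϱ⁻¹‖b − Ax̃‖₂`»,
  and §5 (5.1)–(5.2), p. 16, the form actually used: with `As⁻ = A − sI − Δ⁻`, `As⁺ = A + sI + Δ⁺`,
  > Suppose matrices `P⁻, Q⁻, P⁺, Q⁺` are given such that `‖As⁻ − P⁻Q⁻P⁻ᵀ‖₂ ≤ α⁻` and
  > `‖As⁺ − P⁺Q⁺P⁺ᵀ‖₂ ≤ α⁺` (5.1). […] let `k` be the index of the smallest positive eigenvalue of `Q⁻`.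
  > Then `λ_k(A) > s − α⁻`. Denote by `ℓ` the index of the smallest positive eigenvalue of `Q⁺` […]
  > `λ_{ℓ+1}(A) ≤ −s + α⁺`. […] If the inertia of `Q⁻` and `Q⁺` coincide, then `k = ℓ` and
  > `σ_min(A) = min(−λ_{k+1}(A), λ_k(A)) ≥ s − max(α⁻, α⁺)` (5.2).

RENDERING (as in the two companion files). `A` is a real symmetric (`IsHermitian`) matrix over an
arbitrary finite index type. A shifted factorisation is an exact identity `A − Δ − θ·1 = S·diagonal d·Sᵀ`
with `det S` a unit and no zero pivot `dᵢ` (the checker's float factors `P`, its EXACTLY formed residual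
`Δ`, and the shift `θ = s` resp. `θ = −s`); the residual enters only through quadratic-form bounds
`−α·xᵀx ≤ xᵀΔx` resp. `xᵀΔx ≤ α·xᵀx` (any certified bound on `‖Δ‖₂`, e.g. Schur's row-sum test
`EigenvalueCount.abs_dotProduct_mulVec_le_of_abs_le_rowSum`). «Equal inertia» is rendered by the equality of the
numbers of POSITIVE pivots (with no zero pivots and equal size this is the printed hypothesis). A LOWER BOUND
`t` FOR THE SMALLEST SINGULAR VALUE is rendered, as in `SingularValueVerificationBounds`, by its defining
property `∀ v, t‖v‖₂ ≤ ‖Av‖₂` (no singular value decomposition needed; monotone in `t`). The floating-point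
analysis that PRODUCES `α` (Part I §2, Part II §2) is not part of the statement.

WHAT IS PROVED (0 definitions, 0 named facts, 0 sorry).
* `forall_lt_or_le_of_two_shift_inertia` — the heart of Thm 1.1 / (5.2): under the two certificates with
  equally many positive pivots, EVERY eigenvalue `λ` of `A` satisfies `s − α⁻ < λ` or `λ ≤ −s + α⁺`
  (no eigenvalue in the gap `(−s + α⁺, s − α⁻]`);
* `le_abs_eigenvalues_of_two_shift_inertia` — hence `t ≤ |λᵢ(A)|` for every `i` and every
  `t ≤ min(s − α⁻, s − α⁺)`;
* `norm_mulVec_ge_of_le_abs_eigenvalues` — glue (Weinstein's inequality contraposed): for real symmetric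
  `A`, `t ≤ |λᵢ|` for all `i` gives `t‖v‖₂ ≤ ‖Av‖₂` for all `v`;
* `sigma_lower_of_two_shift_inertia` — **Theorem 1.1 (1.3) / (5.2)**: `(s − max(α⁻, α⁺))‖v‖₂ ≤ ‖Av‖₂`;
* `isUnit_det_of_two_shift_inertia`, `norm_inv_mulVec_sub_le_of_two_shift_inertia` — the use made of it
  (Part II p. 3): `s > max(α⁻, α⁺)` ⇒ `A` nonsingular and `‖A⁻¹b − x̃‖₂ ≤ ‖b − Ax̃‖₂/(s − max(α⁻, α⁺))`;
* `forall_lt_eigenvalues_of_pos_pivots`, `sigma_lower_of_pos_pivots` — **(1.4)**: one certificate at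
  shift `s` with ALL pivots positive gives `s − α < λᵢ(A)` for all `i` and `(s − α)‖v‖₂ ≤ ‖Av‖₂`.
The printed strict `>` in (1.3) corresponds to strict residual bounds; with `≤`-bounds on the forms the
conclusions are as stated (strict on the positive side, `≤` on the negative side).

* §5 (private `certificate_transport`) `sigma_lower_of_inertia_of_anticommuting` — a symmetric involution `J` with
  `JBJ = −B` turns ONE certificate at shift `−θ` into a second one at shift `+θ` (pivots negated), so §3
  applies; `sigma_lower_of_augmented_inertia`, `norm_inv_mulVec_sub_le_of_augmented_inertia` — **Terao–Ozaki
  2025 Lemma 1 / Part II (1.4)** for `B = [[0, A₀ᵀ],[A₀, 0]]`, `J = diag(1, −1)`: one `LDLᵀ`-type certificate of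
  `B + θ·1` with as many positive as negative pivots and `xᵀΔx ≤ ρ·xᵀx` gives `(θ − ρ)‖v‖₂ ≤ ‖A₀v‖₂`, hence
  (for `θ > ρ`) `A₀` nonsingular and `‖A₀⁻¹b − x̃‖₂ ≤ ‖b − A₀x̃‖₂/(θ − ρ)` — without any `σ(B) = ±σ(A₀)` lemma.
  Source for §5: T. Terao, K. Ozaki, *Method for verifying solutions of sparse linear systems with general
  coefficients*, Appl. Math. Comput. 490 (2025) 129204 = arXiv:2406.02033 [TeraoOzaki2025] (held
  `paper:terao2024-…`, p. 4–5): «Lemma 1. Let `Ā ∈ ℝ²ⁿˣ²ⁿ`, `θ ∈ ℝ`, and `L̂, D̂ ∈ ℝ²ⁿˣ²ⁿ` be given. If the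
  number of positive (or negative) eigenvalues for `D̂` is equal to `n`, it holds that `σ_min(A) ≥ |θ| − ρ`,
  where `ρ ≥ ‖Ā + θI − L̂D̂L̂ᵀ‖`. In particular, when `|θ| > ρ`, matrix `A` is nonsingular and
  `‖A⁻¹‖ ≤ 1/(|θ| − ρ)` (7)» (we take `θ` of either sign with the shift written `B − Δ − (−θ)·1`; for `θ ≤ ρ`
  the bound is vacuous).

NOT HERE: rectangular `A₀` (Part II §7 least squares), complex Hermitian data, and any floating-point
semantics.
-/

noncomputable section

open scoped Matrix

namespace Literature.Analysis.Matrix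

namespace InertiaSigmaMin

open Finset _root_.Matrix WithLp
open Literature.Analysis.Matrix.EigenvalueCount

variable {ι : Type*} [Fintype ι] [DecidableEq ι]

/-! ### §1 The eigenvalue dichotomy from two shifted inertia certificates -/

section Dichotomy

variable {A Δm Δp Sm Sp : Matrix ι ι ℝ} {dm dp : ι → ℝ} {s αm αp : ℝ}

/-- **Rump's two-shift inertia argument (Thm 1.1 / (5.2)), eigenvalue form.** Let `A` be real symmetric,
`A − Δ⁻ − s·1 = S⁻·diag(d⁻)·S⁻ᵀ` and `A − Δ⁺ − (−s)·1 = S⁺·diag(d⁺)·S⁺ᵀ` with `det S^±` units and no zero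
pivots, `−α⁻·xᵀx ≤ xᵀΔ⁻x` and `xᵀΔ⁺x ≤ α⁺·xᵀx` for all `x`, and suppose `d⁻` and `d⁺` have equally many
positive entries. Then every eigenvalue `λ` of `A` satisfies `s − α⁻ < λ` or `λ ≤ −s + α⁺`.
[cite: Rump2026SparseI, Thm 1.1 (1.3)] [cite: Rump2026SparseII, (5.1)–(5.2)] [cite: Rump1995SparseZAMM, Thm 1.1] -/
theorem forall_lt_or_le_of_two_shift_inertia (hA : A.IsHermitian)
    (hSm : IsUnit Sm.det) (hm : A - Δm - s • 1 = Sm * diagonal dm * Smᵀ) (hdm : ∀ i, dm i ≠ 0)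
    (hSp : IsUnit Sp.det) (hp : A - Δp - (-s) • 1 = Sp * diagonal dp * Spᵀ) (hdp : ∀ i, dp i ≠ 0)
    (hΔm : ∀ x : ι → ℝ, -αm * (x ⬝ᵥ x) ≤ x ⬝ᵥ Δm *ᵥ x)
    (hΔp : ∀ x : ι → ℝ, x ⬝ᵥ Δp *ᵥ x ≤ αp * (x ⬝ᵥ x))
    (hcount : Fintype.card {i // 0 < dm i} = Fintype.card {i // 0 < dp i}) (i : ι) :
    s - αm < hA.eigenvalues i ∨ hA.eigenvalues i ≤ -s + αp := by
  -- the two one-sided count certificates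
  have h1 : Fintype.card {i // 0 < dm i} ≤ (univ.filter fun j => s - αm < hA.eigenvalues j).card :=
    card_pos_le_card_eigenvalues_gt_sub_of_residual hA hSm hm hdm hΔm
  have h2 : (univ.filter fun j => -s + αp < hA.eigenvalues j).card ≤ Fintype.card {i // 0 < dp i} :=
    card_eigenvalues_gt_add_le_card_pos_of_residual hA hSp hp hdp hΔp
  by_contra hcon
  push Not at hcon
  obtain ⟨hle, hgt⟩ := hcon
  -- then `{j | s − α⁻ < λⱼ} ⊂ {j | −s + α⁺ < λⱼ}` strictly (the latter contains `i`), contradicting the counts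
  have hsub : (univ.filter fun j => s - αm < hA.eigenvalues j) ⊂
      (univ.filter fun j => -s + αp < hA.eigenvalues j) := by
    rw [Finset.ssubset_iff_of_subset]
    · exact ⟨i, mem_filter.2 ⟨mem_univ i, hgt⟩, fun hi => (not_lt.2 hle) (mem_filter.1 hi).2⟩
    · intro j hj
      exact mem_filter.2 ⟨mem_univ j, lt_trans (lt_of_lt_of_le hgt hle) (mem_filter.1 hj).2⟩
  have := Finset.card_lt_card hsub
  omega

/-- Consequently `t ≤ |λᵢ(A)|` for all `i` whenever `t ≤ s − α⁻` and `t ≤ s − α⁺` (so no eigenvalue of `A`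
has modulus below `s − max(α⁻, α⁺)`). [cite: Rump2026SparseII, (5.2)] [cite: Rump2026SparseI, Thm 1.1 (1.3)] -/
theorem le_abs_eigenvalues_of_two_shift_inertia (hA : A.IsHermitian)
    (hSm : IsUnit Sm.det) (hm : A - Δm - s • 1 = Sm * diagonal dm * Smᵀ) (hdm : ∀ i, dm i ≠ 0)
    (hSp : IsUnit Sp.det) (hp : A - Δp - (-s) • 1 = Sp * diagonal dp * Spᵀ) (hdp : ∀ i, dp i ≠ 0)
    (hΔm : ∀ x : ι → ℝ, -αm * (x ⬝ᵥ x) ≤ x ⬝ᵥ Δm *ᵥ x)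
    (hΔp : ∀ x : ι → ℝ, x ⬝ᵥ Δp *ᵥ x ≤ αp * (x ⬝ᵥ x))
    (hcount : Fintype.card {i // 0 < dm i} = Fintype.card {i // 0 < dp i})
    {t : ℝ} (htm : t ≤ s - αm) (htp : t ≤ s - αp) (i : ι) :
    t ≤ |hA.eigenvalues i| := by
  rcases forall_lt_or_le_of_two_shift_inertia hA hSm hm hdm hSp hp hdp hΔm hΔp hcount i with h | h
  · exact le_trans (le_of_lt (lt_of_le_of_lt htm h)) (le_abs_self _)
  · have : hA.eigenvalues i ≤ -t := by linarith
    exact le_trans (by linarith) (neg_le_abs _)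

end Dichotomy

/-! ### §2 From eigenvalue moduli to the `σ_min` rendering (Weinstein contraposed) -/

section SigmaLower

variable {A : Matrix ι ι ℝ}

/-- For a real symmetric `A`: if every eigenvalue has `t ≤ |λᵢ|`, then `t‖v‖₂ ≤ ‖Av‖₂` for every `v`
(i.e. `σ_min(A) ≥ t`; proof: otherwise Weinstein's inequality at `μ = 0` produces an eigenvalue of modulus
`< t`). [cite: HornJohnson2013, Thm 6.3.14] -/
theorem norm_mulVec_ge_of_le_abs_eigenvalues (hA : A.IsHermitian) {t : ℝ}
    (ht : ∀ i, t ≤ |hA.eigenvalues i|) (v : ι → ℝ) :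
    t * ‖toLp 2 v‖ ≤ ‖toLp 2 (A *ᵥ v)‖ := by
  by_cases hv : v = 0
  · subst hv; simp
  by_contra hcon
  push Not at hcon
  have hvpos : 0 < ‖toLp 2 v‖ := norm_pos_iff.2 fun h0 => hv ((toLp_eq_zero 2).1 h0)
  set η : ℝ := ‖toLp 2 (A *ᵥ v)‖ / ‖toLp 2 v‖ with hηdef
  have hη0 : 0 ≤ η := div_nonneg (norm_nonneg _) (le_of_lt hvpos)
  have hηt : η < t := by
    rw [hηdef, div_lt_iff₀ hvpos]; exact hcon
  have hsq : ∑ i, ‖(A *ᵥ v) i‖ ^ 2 ≤ η ^ 2 * ∑ i, ‖v i‖ ^ 2 := by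
    have h1 : ‖toLp 2 (A *ᵥ v)‖ ^ 2 = ∑ i, ‖(A *ᵥ v) i‖ ^ 2 := by
      rw [EuclideanSpace.norm_sq_eq]
    have h2 : ‖toLp 2 v‖ ^ 2 = ∑ i, ‖v i‖ ^ 2 := by
      rw [EuclideanSpace.norm_sq_eq]
    rw [← h1, ← h2]
    have : ‖toLp 2 (A *ᵥ v)‖ = η * ‖toLp 2 v‖ := by
      rw [hηdef, div_mul_cancel₀ _ (ne_of_gt hvpos)]
    rw [this, mul_pow]
  obtain ⟨i, hi⟩ :=
    Literature.Analysis.InnerProduct.exists_abs_eigenvalues_le_of_sum_norm_sq_mulVec_le hA hv hη0 hsq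
  exact absurd (lt_of_le_of_lt hi hηt) (not_lt.2 (ht i))

end SigmaLower

/-! ### §3 Theorem 1.1 as printed, and its use -/

section Main

variable {A Δm Δp Sm Sp : Matrix ι ι ℝ} {dm dp : ι → ℝ} {s αm αp : ℝ}

/-- **Rump, Theorem 1.1 (1.3) — two shifted factorisations with equal inertia bound `σ_min` from below.**
Real symmetric `A`; `A − Δ⁻ − s·1 = S⁻·diag(d⁻)·S⁻ᵀ`, `A − Δ⁺ + s·1 = S⁺·diag(d⁺)·S⁺ᵀ` (`det S^±` units, no
zero pivots, equally many positive pivots); `−α⁻·xᵀx ≤ xᵀΔ⁻x`, `xᵀΔ⁺x ≤ α⁺·xᵀx`. Then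
`(s − max(α⁻, α⁺))·‖v‖₂ ≤ ‖Av‖₂` for every `v`, i.e. `σ_min(A) ≥ s − max(α⁻, α⁺)`.
[cite: Rump2026SparseI, Thm 1.1 (1.3)] [cite: Rump2026SparseII, Thm 1.1 and (5.2)] [cite: Rump1995SparseZAMM, Thm 1.1] -/
theorem sigma_lower_of_two_shift_inertia (hA : A.IsHermitian)
    (hSm : IsUnit Sm.det) (hm : A - Δm - s • 1 = Sm * diagonal dm * Smᵀ) (hdm : ∀ i, dm i ≠ 0)
    (hSp : IsUnit Sp.det) (hp : A - Δp - (-s) • 1 = Sp * diagonal dp * Spᵀ) (hdp : ∀ i, dp i ≠ 0)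
    (hΔm : ∀ x : ι → ℝ, -αm * (x ⬝ᵥ x) ≤ x ⬝ᵥ Δm *ᵥ x)
    (hΔp : ∀ x : ι → ℝ, x ⬝ᵥ Δp *ᵥ x ≤ αp * (x ⬝ᵥ x))
    (hcount : Fintype.card {i // 0 < dm i} = Fintype.card {i // 0 < dp i}) (v : ι → ℝ) :
    (s - max αm αp) * ‖toLp 2 v‖ ≤ ‖toLp 2 (A *ᵥ v)‖ :=
  norm_mulVec_ge_of_le_abs_eigenvalues hA
    (le_abs_eigenvalues_of_two_shift_inertia hA hSm hm hdm hSp hp hdp hΔm hΔp hcount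
      (by linarith [le_max_left αm αp]) (by linarith [le_max_right αm αp])) v

/-- With `max(α⁻, α⁺) < s` the matrix `A` is nonsingular («`ϱ > 0` implies that … `A` is nonsingular»).
[cite: Rump2026SparseII, §1 p. 2–3] [cite: Rump2026SparseI, Thm 1.1] -/
theorem isUnit_det_of_two_shift_inertia (hA : A.IsHermitian)
    (hSm : IsUnit Sm.det) (hm : A - Δm - s • 1 = Sm * diagonal dm * Smᵀ) (hdm : ∀ i, dm i ≠ 0)
    (hSp : IsUnit Sp.det) (hp : A - Δp - (-s) • 1 = Sp * diagonal dp * Spᵀ) (hdp : ∀ i, dp i ≠ 0)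
    (hΔm : ∀ x : ι → ℝ, -αm * (x ⬝ᵥ x) ≤ x ⬝ᵥ Δm *ᵥ x)
    (hΔp : ∀ x : ι → ℝ, x ⬝ᵥ Δp *ᵥ x ≤ αp * (x ⬝ᵥ x))
    (hcount : Fintype.card {i // 0 < dm i} = Fintype.card {i // 0 < dp i}) (hs : max αm αp < s) :
    IsUnit A.det :=
  SingularValueVerification.isUnit_det_of_sigma_lower (sub_pos.2 hs)
    (sigma_lower_of_two_shift_inertia hA hSm hm hdm hSp hp hdp hΔm hΔp hcount)

/-- **The verified error bound it yields** (Part II p. 3: `‖A⁻¹b − x̃‖ ≤ ϱ⁻¹‖b − Ax̃‖₂` with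
`ϱ = s − max(α⁻, α⁺) > 0`), for every approximate solution `x̃`.
[cite: Rump2026SparseII, §1 p. 3] [cite: Rump2026SparseI, §4] -/
theorem norm_inv_mulVec_sub_le_of_two_shift_inertia (hA : A.IsHermitian)
    (hSm : IsUnit Sm.det) (hm : A - Δm - s • 1 = Sm * diagonal dm * Smᵀ) (hdm : ∀ i, dm i ≠ 0)
    (hSp : IsUnit Sp.det) (hp : A - Δp - (-s) • 1 = Sp * diagonal dp * Spᵀ) (hdp : ∀ i, dp i ≠ 0)
    (hΔm : ∀ x : ι → ℝ, -αm * (x ⬝ᵥ x) ≤ x ⬝ᵥ Δm *ᵥ x)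
    (hΔp : ∀ x : ι → ℝ, x ⬝ᵥ Δp *ᵥ x ≤ αp * (x ⬝ᵥ x))
    (hcount : Fintype.card {i // 0 < dm i} = Fintype.card {i // 0 < dp i}) (hs : max αm αp < s)
    (b xt : ι → ℝ) :
    ‖toLp 2 (A⁻¹ *ᵥ b - xt)‖ ≤ ‖toLp 2 (b - A *ᵥ xt)‖ / (s - max αm αp) :=
  SingularValueVerification.norm_toLp_inv_mulVec_sub_le (sub_pos.2 hs)
    (sigma_lower_of_two_shift_inertia hA hSm hm hdm hSp hp hdp hΔm hΔp hcount) b xt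

end Main

/-! ### §4 The one-sided case (1.4): all pivots positive -/

section OneSided

variable {A Δ S : Matrix ι ι ℝ} {d : ι → ℝ} {s α : ℝ}

/-- **(1.4), eigenvalue form.** `A − Δ − s·1 = S·diag(d)·Sᵀ` with `det S` a unit and ALL pivots positive,
`−α·xᵀx ≤ xᵀΔx` ⇒ `s − α < λᵢ(A)` for every `i`. [cite: Rump2026SparseI, Thm 1.1 (1.4)] [cite: Rump2026SparseII, (1.3)] -/
theorem forall_lt_eigenvalues_of_pos_pivots (hA : A.IsHermitian) (hS : IsUnit S.det)
    (h : A - Δ - s • 1 = S * diagonal d * Sᵀ) (hd : ∀ i, 0 < d i)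
    (hΔ : ∀ x : ι → ℝ, -α * (x ⬝ᵥ x) ≤ x ⬝ᵥ Δ *ᵥ x) (i : ι) :
    s - α < hA.eigenvalues i := by
  have h1 : Fintype.card {i // 0 < d i} ≤ (univ.filter fun j => s - α < hA.eigenvalues j).card :=
    card_pos_le_card_eigenvalues_gt_sub_of_residual hA hS h (fun j => ne_of_gt (hd j)) hΔ
  have hall : Fintype.card {i // 0 < d i} = Fintype.card ι :=
    Fintype.card_of_subtype univ fun j => by simpa using hd j
  have hfull : (univ.filter fun j => s - α < hA.eigenvalues j) = univ := by
    apply Finset.eq_univ_of_card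
    refine le_antisymm (card_le_univ _) ?_
    rw [← hall]; exact h1
  have hi : i ∈ univ.filter fun j => s - α < hA.eigenvalues j := by rw [hfull]; exact mem_univ i
  exact (mem_filter.1 hi).2

/-- **(1.4), `σ_min` form.** Under the same one-sided certificate,
`(s − α)‖v‖₂ ≤ ‖Av‖₂` for all `v` (and `A` is positive definite, cf.
`SingularValueVerification.sigma_lower_of_symm_shifted_residual` for the Cholesky rendering).
[cite: Rump2026SparseI, Thm 1.1 (1.4)] [cite: Rump2026SparseII, (1.3)] -/
theorem sigma_lower_of_pos_pivots (hA : A.IsHermitian) (hS : IsUnit S.det)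
    (h : A - Δ - s • 1 = S * diagonal d * Sᵀ) (hd : ∀ i, 0 < d i)
    (hΔ : ∀ x : ι → ℝ, -α * (x ⬝ᵥ x) ≤ x ⬝ᵥ Δ *ᵥ x) (v : ι → ℝ) :
    (s - α) * ‖toLp 2 v‖ ≤ ‖toLp 2 (A *ᵥ v)‖ :=
  norm_mulVec_ge_of_le_abs_eigenvalues hA
    (fun i => le_trans (le_of_lt (forall_lt_eigenvalues_of_pos_pivots hA hS h hd hΔ i))
      (le_abs_self _)) v

end OneSided

/-! ### §5 The augmented matrix: ONE shifted factorisation of `[[0, Aᵀ],[A, 0]]` (Terao–Ozaki 2025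
Lemma 1; Rump Part II (1.4)) — reduced to §3 by conjugation with the signature involution `J = diag(1, −1)`,
so that no «`σ(B) = ±σ(A)`» lemma is needed -/

section Transport

variable {B Δ S J : Matrix ι ι ℝ} {d : ι → ℝ} {θ ρ : ℝ}

/-- **Certificate transport under an anticommuting symmetric involution.** If `Jᵀ = J`, `J*J = 1`,
`J*B*J = −B` and `B − Δ − θ·1 = S·diag(d)·Sᵀ`, then `B − (−(JΔJ)) − (−θ)·1 = (JS)·diag(−d)·(JS)ᵀ`: the
certificate at shift `θ` with pivots `d` yields one at shift `−θ` with pivots `−d`. [folklore] -/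
private theorem certificate_transport (hJt : Jᵀ = J) (hJJ : J * J = 1) (hJB : J * B * J = -B)
    (h : B - Δ - θ • 1 = S * diagonal d * Sᵀ) :
    B - (-(J * Δ * J)) - (-θ) • (1 : Matrix ι ι ℝ) = (J * S) * diagonal (-d) * (J * S)ᵀ := by
  have h1 : J * (B - Δ - θ • 1) * J = -B - J * Δ * J - θ • (1 : Matrix ι ι ℝ) := by
    rw [Matrix.mul_sub, Matrix.mul_sub, Matrix.sub_mul, Matrix.sub_mul, hJB, Matrix.mul_smul,
      Matrix.smul_mul, Matrix.mul_one, hJJ]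
  have h2 : J * (S * diagonal d * Sᵀ) * J = (J * S) * diagonal d * (J * S)ᵀ := by
    rw [transpose_mul, hJt]; simp only [Matrix.mul_assoc]
  have h3 : -B - J * Δ * J - θ • (1 : Matrix ι ι ℝ) = (J * S) * diagonal d * (J * S)ᵀ := by
    rw [← h1, h, h2]
  have h4 : B - (-(J * Δ * J)) - (-θ) • (1 : Matrix ι ι ℝ) = -(-B - J * Δ * J - θ • (1 : Matrix ι ι ℝ)) := by
    rw [neg_smul]; abel
  have hdn : (diagonal (-d) : Matrix ι ι ℝ) = -diagonal d := by
    ext i j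
    by_cases hij : i = j
    · subst hij; simp
    · simp [hij]
  rw [h4, h3, hdn]
  simp only [Matrix.mul_neg, Matrix.neg_mul]

/-- Under `Jᵀ = J`, `J*J = 1`: `xᵀ(JΔJ)x = (Jx)ᵀΔ(Jx)` and `(Jx)ᵀ(Jx) = xᵀx`; hence a form bound
`xᵀΔx ≤ ρ·xᵀx` (all `x`) gives `−ρ·xᵀx ≤ xᵀ(−(JΔJ))x`. [folklore] -/
private theorem neg_mul_le_form_neg_conj (hJt : Jᵀ = J) (hJJ : J * J = 1)
    (hΔ : ∀ x : ι → ℝ, x ⬝ᵥ Δ *ᵥ x ≤ ρ * (x ⬝ᵥ x)) (x : ι → ℝ) :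
    -ρ * (x ⬝ᵥ x) ≤ x ⬝ᵥ (-(J * Δ * J)) *ᵥ x := by
  have hJx : x ᵥ* J = J *ᵥ x := by rw [← vecMul_transpose, hJt]
  have hform : x ⬝ᵥ (J * Δ * J) *ᵥ x = (J *ᵥ x) ⬝ᵥ Δ *ᵥ (J *ᵥ x) := by
    rw [← mulVec_mulVec, ← mulVec_mulVec, dotProduct_mulVec, hJx]
  have hnorm : (J *ᵥ x) ⬝ᵥ (J *ᵥ x) = x ⬝ᵥ x := by
    nth_rewrite 1 [← hJx]
    rw [dotProduct_mulVec, vecMul_vecMul, hJJ, vecMul_one]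
  rw [neg_mulVec, dotProduct_neg, hform, neg_mul]
  exact neg_le_neg (hnorm ▸ hΔ (J *ᵥ x))

/-- **One certificate + anticommuting involution ⇒ the two-shift situation.** Real symmetric `B` with
`Jᵀ = J`, `J*J = 1`, `J*B*J = −B`; ONE certificate `B − Δ − (−θ)·1 = S·diag(d)·Sᵀ` (`det S` a unit, no zero
pivot) with as many positive as negative pivots; `xᵀΔx ≤ ρ·xᵀx` (only this UPPER form bound on the residual is
needed — the printed `ρ ≥ ‖Δ‖` gives both sides). Then `(θ − ρ)‖w‖₂ ≤ ‖Bw‖₂` for all `w`.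
[cite: TeraoOzaki2025, Lemma 1 (proof)] [cite: Rump2026SparseII, (1.4)] -/
theorem sigma_lower_of_inertia_of_anticommuting (hB : B.IsHermitian)
    (hJt : Jᵀ = J) (hJJ : J * J = 1) (hJB : J * B * J = -B)
    (hS : IsUnit S.det) (h : B - Δ - (-θ) • 1 = S * diagonal d * Sᵀ) (hd : ∀ i, d i ≠ 0)
    (hΔ : ∀ x : ι → ℝ, x ⬝ᵥ Δ *ᵥ x ≤ ρ * (x ⬝ᵥ x))
    (hcount : Fintype.card {i // 0 < d i} = Fintype.card {i // d i < 0}) (w : ι → ℝ) :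
    (θ - ρ) * ‖toLp 2 w‖ ≤ ‖toLp 2 (B *ᵥ w)‖ := by
  -- the transported certificate at shift `θ` with pivots `−d`
  have hm : B - (-(J * Δ * J)) - θ • (1 : Matrix ι ι ℝ) = (J * S) * diagonal (-d) * (J * S)ᵀ := by
    have := certificate_transport (θ := -θ) hJt hJJ hJB h
    rwa [neg_neg] at this
  have hJS : IsUnit (J * S).det := by
    rw [det_mul]; exact (isUnit_det_of_left_inverse hJJ).mul hS
  have hdm : ∀ i, (-d) i ≠ 0 := fun i => by simpa using hd i
  have hcount' : Fintype.card {i // 0 < (-d) i} = Fintype.card {i // 0 < d i} := by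
    rw [hcount]
    exact Fintype.card_congr (Equiv.subtypeEquivRight fun i => by simp)
  have key := sigma_lower_of_two_shift_inertia hB hJS hm hdm hS h hd
    (neg_mul_le_form_neg_conj hJt hJJ hΔ) hΔ hcount' w
  simpa only [max_self] using key

end Transport

section Augmented

variable {A Δ S : Matrix (ι ⊕ ι) (ι ⊕ ι) ℝ} {A₀ : Matrix ι ι ℝ} {d : ι ⊕ ι → ℝ} {θ ρ : ℝ}

omit [DecidableEq ι] in
/-- `‖(u; v)‖₂² = ‖u‖₂² + ‖v‖₂²` on `ℝ^{ι ⊕ ι}`. [folklore] -/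
private theorem norm_toLp_sumElim_sq (u v : ι → ℝ) :
    ‖toLp 2 (Sum.elim u v)‖ ^ 2 = ‖toLp 2 u‖ ^ 2 + ‖toLp 2 v‖ ^ 2 := by
  simp only [EuclideanSpace.norm_sq_eq, Fintype.sum_sum_type, Sum.elim_inl, Sum.elim_inr]

/-- **Terao–Ozaki, Lemma 1 / Rump Part II (1.4): the augmented-matrix inertia certificate.** Let `A₀` be a
real square matrix and `B := [[0, A₀ᵀ],[A₀, 0]]`. If `B − Δ + θ·1 = S·diag(d)·Sᵀ` with `det S` a unit, no zero
pivot and as many positive as negative pivots (the printed «number of positive (or negative) eigenvalues of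
`D̂` equal to `n`»), and `xᵀΔx ≤ ρ·xᵀx` for all `x` (implied by the printed `ρ ≥ ‖B + θI − L̂D̂L̂ᵀ‖₂`;
the lower form bound is not needed), then
`(θ − ρ)‖v‖₂ ≤ ‖A₀v‖₂` for every `v`, i.e. `σ_min(A₀) ≥ θ − ρ`.
[cite: TeraoOzaki2025, Lemma 1 (7)] [cite: Rump2026SparseII, (1.4) and §6] -/
theorem sigma_lower_of_augmented_inertia (hS : IsUnit S.det)
    (h : fromBlocks 0 A₀ᵀ A₀ 0 - Δ - (-θ) • 1 = S * diagonal d * Sᵀ) (hd : ∀ i, d i ≠ 0)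
    (hΔ : ∀ x : ι ⊕ ι → ℝ, x ⬝ᵥ Δ *ᵥ x ≤ ρ * (x ⬝ᵥ x))
    (hcount : Fintype.card {i // 0 < d i} = Fintype.card {i // d i < 0}) (v : ι → ℝ) :
    (θ - ρ) * ‖toLp 2 v‖ ≤ ‖toLp 2 (A₀ *ᵥ v)‖ := by
  set B : Matrix (ι ⊕ ι) (ι ⊕ ι) ℝ := fromBlocks 0 A₀ᵀ A₀ 0 with hBdef
  set J : Matrix (ι ⊕ ι) (ι ⊕ ι) ℝ := fromBlocks 1 0 0 (-1) with hJdef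
  have hB : B.IsHermitian := by
    refine IsHermitian.fromBlocks isHermitian_zero ?_ isHermitian_zero
    rw [conjTranspose_eq_transpose_of_trivial, transpose_transpose]
  have hJt : Jᵀ = J := by
    rw [hJdef, fromBlocks_transpose]; simp
  have hJJ : J * J = 1 := by
    rw [hJdef, fromBlocks_multiply]; simp
  have hJB : J * B * J = -B := by
    rw [hJdef, hBdef, fromBlocks_multiply, fromBlocks_multiply, fromBlocks_neg]; simp
  have hw := sigma_lower_of_inertia_of_anticommuting hB hJt hJJ hJB hS h hd hΔ hcount
    (Sum.elim v (0 : ι → ℝ))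
  -- `‖(v; 0)‖₂ = ‖v‖₂` and `B(v; 0) = (0; A₀v)`
  have hBv : B *ᵥ Sum.elim v (0 : ι → ℝ) = Sum.elim (0 : ι → ℝ) (A₀ *ᵥ v) := by
    rw [hBdef, fromBlocks_mulVec, Sum.elim_comp_inl, Sum.elim_comp_inr]
    simp
  have hn1 : ‖toLp 2 (Sum.elim v (0 : ι → ℝ))‖ = ‖toLp 2 v‖ := by
    have := norm_toLp_sumElim_sq v (0 : ι → ℝ)
    rw [toLp_zero, norm_zero, zero_pow two_ne_zero, add_zero] at this
    exact (sq_eq_sq₀ (norm_nonneg _) (norm_nonneg _)).1 this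
  have hn2 : ‖toLp 2 (Sum.elim (0 : ι → ℝ) (A₀ *ᵥ v))‖ = ‖toLp 2 (A₀ *ᵥ v)‖ := by
    have := norm_toLp_sumElim_sq (0 : ι → ℝ) (A₀ *ᵥ v)
    rw [toLp_zero, norm_zero, zero_pow two_ne_zero, zero_add] at this
    exact (sq_eq_sq₀ (norm_nonneg _) (norm_nonneg _)).1 this
  rw [hBv, hn1, hn2] at hw
  exact hw

/-- Hence `θ > ρ` proves `A₀` nonsingular with `‖A₀⁻¹b − x̃‖₂ ≤ ‖b − A₀x̃‖₂/(θ − ρ)` («when `|θ| > ρ`, matrix `A`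
is nonsingular and `‖A⁻¹‖ ≤ 1/(|θ| − ρ)`»). [cite: TeraoOzaki2025, Lemma 1 (7)] [cite: Rump2026SparseII, §1 p. 3] -/
theorem norm_inv_mulVec_sub_le_of_augmented_inertia (hS : IsUnit S.det)
    (h : fromBlocks 0 A₀ᵀ A₀ 0 - Δ - (-θ) • 1 = S * diagonal d * Sᵀ) (hd : ∀ i, d i ≠ 0)
    (hΔ : ∀ x : ι ⊕ ι → ℝ, x ⬝ᵥ Δ *ᵥ x ≤ ρ * (x ⬝ᵥ x))
    (hcount : Fintype.card {i // 0 < d i} = Fintype.card {i // d i < 0}) (hθ : ρ < θ) (b xt : ι → ℝ) :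
    IsUnit A₀.det ∧ ‖toLp 2 (A₀⁻¹ *ᵥ b - xt)‖ ≤ ‖toLp 2 (b - A₀ *ᵥ xt)‖ / (θ - ρ) :=
  ⟨SingularValueVerification.isUnit_det_of_sigma_lower (sub_pos.2 hθ)
      (sigma_lower_of_augmented_inertia hS h hd hΔ hcount),
    SingularValueVerification.norm_toLp_inv_mulVec_sub_le (sub_pos.2 hθ)
      (sigma_lower_of_augmented_inertia hS h hd hΔ hcount) b xt⟩

end Augmented

end InertiaSigmaMin

end Literature.Analysis.Matrix

end
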